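import Mathlib
import HarnessLib
import Summits.Ventures.LatticeQCDFlow.Exactness.FlowAcceptanceOverlap
import Summits.Ventures.LatticeQCDFlow.Scaling.AcceptanceEssEightNinthsIntegral

/-!
# LatticeQCDFlow / Scaling — `acc ≥ (8/9)·ESS` on a general space, VI: NONNEGATIVE densities with
# an explicit weight (`p = b·q`, zeros of the model allowed)

HONEST FRAMING: exact (Metropolis-corrected) sampling algorithms for lattice gauge theory;
figures of merit are autocorrelation/cost numbers at stated couplings and volumes; no
continuum-physics claim.

Venture `LatticeQCDFlow` (cell pub-lqcd), topic `Scaling`; FANOUT row 3 (`s0-u1-a`, S0-B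
implementation A, GEN-12).  NEW WORK of the cell, not a published result; NO definition is
introduced.  Part II (`Scaling/AcceptanceEssEightNinthsDensities`) states the law for densities
`w, q > 0` EVERYWHERE, with the weight `b = w/q`.  Group-valued samplers written in class-angle or
other reduced coordinates have model densities that VANISH on the boundary of the chart (e.g. the
SU(2) Haar class density `(2/π) sin² α` at `α ∈ {0, π}`), where `w/q` is undefined.  This file
restates the floor for NONNEGATIVE densities, taking the weight `b ≥ 0` as data with `b·q = p`
(so `p` vanishes wherever `q` does — absolute continuity), directly from the layer-cake core of
Part I (`ofReal_eight_ninths_le_overlap`, imported) and row 2's integrability lemmas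
(`Exactness.integrable_min_mul`, `integrable_integral_min_mul`, imported; nonnegativity suffices):

* `lintegral_ofReal_mul_eq` — bookkeeping `∫⁻ ofReal(f)·ofReal(q) = ofReal(∫ f q)`;
* **`eight_ninths_le_meanAccept_of_weight`** — for measurable `p, q, b ≥ 0` with `∫ p = ∫ q = 1`,
  `b·q = p` and `W = ∫ b p dμ` finite and positive:
  `8/(9W) ≤ ∫∫ min(p(x)q(y), p(y)q(x)) dμ dμ`, i.e. `acc ≥ (8/9)·ESS` with `ESS = 1/∫ b p`
  (`= (∫p)²/∫p²/q` where `q > 0`).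

NOT CLAIMED: any acceptance or ESS of ours; nothing re-scored.
-/

namespace Summit.Ventures.LatticeQCDFlow.Theory2

open MeasureTheory ENNReal Set
open Summit.Ventures.LatticeQCDFlow.Exactness

section Weight

variable {X : Type*} [MeasurableSpace X] {μ : Measure X} [SFinite μ] {p q b : X → ℝ}

omit [SFinite μ] in
/-- `∫⁻ ofReal(f)·ofReal(q) = ofReal (∫ f·q)` for `f, q ≥ 0` with `f·q` integrable. [folklore] -/
theorem lintegral_ofReal_mul_eq {f : X → ℝ} (hf0 : ∀ x, 0 ≤ f x) (hq0 : ∀ x, 0 ≤ q x)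
    (hi : Integrable (fun x => f x * q x) μ) :
    ∫⁻ x, ENNReal.ofReal (f x) * ENNReal.ofReal (q x) ∂μ = ENNReal.ofReal (∫ x, f x * q x ∂μ) := by
  rw [ofReal_integral_eq_lintegral_ofReal hi (Filter.Eventually.of_forall fun x =>
    mul_nonneg (hf0 x) (hq0 x))]
  exact lintegral_congr fun x => by rw [← ENNReal.ofReal_mul (hf0 x)]

/-- **`acc ≥ (8/9)·ESS` FOR NONNEGATIVE DENSITIES WITH AN EXPLICIT WEIGHT.**  For measurable
`p, q, b ≥ 0` on an s-finite space with `∫ p = ∫ q = 1`, `b·q = p` pointwise, and `W = ∫ b p dμ`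
finite (integrable) and positive: `8/(9W) ≤ ∫∫ min(p(x)q(y), p(y)q(x)) dμ dμ`. [ours] -/
theorem eight_ninths_le_meanAccept_of_weight (hp0 : ∀ x, 0 ≤ p x) (hpm : Measurable p)
    (hpi : Integrable p μ) (hp1 : ∫ x, p x ∂μ = 1) (hq0 : ∀ x, 0 ≤ q x) (hqm : Measurable q)
    (hqi : Integrable q μ) (hq1 : ∫ x, q x ∂μ = 1) (hb0 : ∀ x, 0 ≤ b x) (hbm : Measurable b)
    (hbq : ∀ x, b x * q x = p x) (hW : Integrable (fun x => b x * p x) μ)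
    (hWpos : 0 < ∫ x, b x * p x ∂μ) :
    8 / (9 * ∫ x, b x * p x ∂μ) ≤ ∫ x, ∫ y, min (p x * q y) (p y * q x) ∂μ ∂μ := by
  set W : ℝ := ∫ x, b x * p x ∂μ with hWdef
  -- the two moments of the core
  have hm1 : ∫⁻ x, ENNReal.ofReal (b x) * ENNReal.ofReal (q x) ∂μ = ENNReal.ofReal 1 := by
    have hi : Integrable (fun x => b x * q x) μ := hpi.congr (Filter.Eventually.of_forall fun x =>
      (hbq x).symm)
    rw [lintegral_ofReal_mul_eq hb0 hq0 hi, ← hp1]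
    congr 1
    exact integral_congr_ae (Filter.Eventually.of_forall fun x => hbq x)
  have hm2 : ∫⁻ x, ENNReal.ofReal (b x ^ 2) * ENNReal.ofReal (q x) ∂μ = ENNReal.ofReal W := by
    have e : ∀ x, b x ^ 2 * q x = b x * p x := fun x => by rw [sq, mul_assoc, hbq x]
    have hi : Integrable (fun x => b x ^ 2 * q x) μ :=
      hW.congr (Filter.Eventually.of_forall fun x => (e x).symm)
    rw [lintegral_ofReal_mul_eq (fun x => sq_nonneg _) hq0 hi, hWdef]
    congr 1
    exact integral_congr_ae (Filter.Eventually.of_forall fun x => e x)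
  -- the overlap, in real form
  have hmin0 : ∀ x y, 0 ≤ min (p x * q y) (p y * q x) := fun x y =>
    le_min (mul_nonneg (hp0 x) (hq0 y)) (mul_nonneg (hp0 y) (hq0 x))
  have hA : ∫⁻ x, ∫⁻ y, ENNReal.ofReal (min (b x) (b y)) * ENNReal.ofReal (q x)
        * ENNReal.ofReal (q y) ∂μ ∂μ
      = ENNReal.ofReal (∫ x, ∫ y, min (p x * q y) (p y * q x) ∂μ ∂μ) := by
    rw [ofReal_integral_eq_lintegral_ofReal (integrable_integral_min_mul hp0 hpm hpi hq0 hqm hqi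
      hq1) (Filter.Eventually.of_forall fun x => integral_nonneg fun y => hmin0 x y)]
    refine lintegral_congr fun x => ?_
    rw [ofReal_integral_eq_lintegral_ofReal (integrable_min_mul hp0 hpm hq0 hqm hqi x)
      (Filter.Eventually.of_forall fun y => hmin0 x y)]
    refine lintegral_congr fun y => ?_
    rw [← ENNReal.ofReal_mul (le_min (hb0 x) (hb0 y)), ← ENNReal.ofReal_mul
      (mul_nonneg (le_min (hb0 x) (hb0 y)) (hq0 x))]
    congr 1
    rw [min_mul_of_nonneg _ _ (hq0 x), min_mul_of_nonneg _ _ (hq0 y)]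
    congr 1
    · rw [hbq x]
    · rw [mul_right_comm, hbq y]
  have h := ofReal_eight_ninths_le_overlap (μ := μ) (b := b) (ρ := fun x => ENNReal.ofReal (q x))
    hbm hb0 hqm.ennreal_ofReal one_pos hWpos hm1 hm2
  rw [hA, one_pow, mul_one] at h
  exact (ENNReal.ofReal_le_ofReal_iff (integral_nonneg fun x => integral_nonneg fun y =>
    hmin0 x y)).1 h

end Weight

end Summit.Ventures.LatticeQCDFlow.Theory2
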